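import Summits.AtomisticToContinuum.Crystallization.Theorems.ChartedPlanarOrderPairModulusTail

/-!
# Smearing a planar lattice sum of moduli against the EXACT Gram form (decomp-a2c lens-3 g25, task «TAIL CONSTANT» (2))

The per-layer-pair Lipschitz constant of the layer force is a lattice sum `Σ_{(i,j) ∈ ℤ²} Φ(r_ij)` of the per-site modulus
`Φ(r) = modulus r = 15 r⁻¹⁴ + 9 r⁻⁸` over common floors `r_ij² = t² + m_ij²` (`t` the height floor, `m_ij ≥ 0` a planar floor with
`‖(i + c₁) a + (j + c₂) b‖ ≤ m_ij + d`).  The leaf of record (`…PairModulusB.norm_layerForce_sub_le_of_height`) bounds it by the PRODUCT of two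
line sums over the diagonalised form `q₁ i² + q₂ j²` — numerically `≈ 20×` the truth.  This file bounds it by the sharp CONTINUUM value:

* §1 pointwise ε-absorption: `‖y‖ ≤ m + R̃` gives `t² + m² ≥ (T₂ + ‖y‖²)/(1+ε)` with `T₂ = (1+ε)t² − (1+1/ε)R̃²`, hence
  `Φ(√(t²+m²)) ≤ 15(1+ε)⁷(T₂+‖y‖²)⁻⁷ + 9(1+ε)⁴(T₂+‖y‖²)⁻⁴` (pure real algebra);
* §2 `Σ_{ij} F ij ≤ ∫ g` whenever `F ij ≤ g` on the unit cell `[i,i+1) × [j,j+1)` (Lebesgue, `lintegral_iUnion`);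
* §3 the radial integral `∫_{ℝ²} (T₂ + ‖(c₁+z₁) a + (c₂+z₂) b‖²)⁻ⁿ dz = π / ((n−1) √G T₂ⁿ⁻¹)` (`G` the Gram determinant; translation
  invariance, the Cholesky shear `z ↦ (‖a‖z₁ + (p/‖a‖)z₂, (√G/‖a‖) z₂)` of determinant `√G` via `map_linearMap_addHaar_eq_smul_addHaar`,
  polar coordinates `lintegral_comp_polarCoord_symm`, and the improper integrals `∫₀^∞ r (T₂+r²)⁻ⁿ dr = T₂¹⁻ⁿ/(2(n−1))`, `n = 4, 7`);
* §4 ★ THE SMEARED BOUND: `Σ_{ij} modulus(√(t² + m_ij²)) ≤ (π/√G)·[15(1+ε)⁷/(6T₂⁶) + 9(1+ε)⁴/(3T₂³)]`, `T₂ = (1+ε)t² − (1+1/ε)(d + R_c)²`,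
  `R_c` any bound of `‖ζ₁ a + ζ₂ b‖` over `|ζ₁|, |ζ₂| ≤ ½` — with summability of the family (needed by `…LayerForceLipschitz.norm_layerForce_sub_le_of_floor`).

Consumer: `…PairModulusSharp` (this generation).  Sorry-free, standard axioms; no instances declared (one local `haveI` of a Mathlib
instance inside proofs), no notation.
-/

noncomputable section

namespace Summit.AtomisticToContinuum.Crystallization.Theorems.ChartedPlanarOrderLatticeSmear

open MeasureTheory Set Real
open scoped RealInnerProductSpace ENNReal
open Summit.AtomisticToContinuum.Crystallization.Theorems.ChartedPlanarOrderRigidityDoor (E3)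
open Summit.AtomisticToContinuum.Crystallization.Theorems.ChartedPlanarOrderPairModulus (modulus modulus_nonneg modulus_sqrt_eq gram_pos)

/-! ## §1 Pointwise ε-absorption of the planar discrepancy -/

-- landing note (hand-2 g12): lens-3's `sq_add_le_eps` ≡ tree `Literature.Analysis.Calculus.add_sq_le_eps` (gate dedup.landed);
-- re-derived below as a local `have` inside `floor_transfer` (per the lens's landing instruction), nothing else changed.

/-- the floor transfer: `‖y‖ ≤ m + R` gives `((1+ε)t² − (1+1/ε)R² + ‖y‖²)/(1+ε) ≤ t² + m²`. -/
theorem floor_transfer {t m R y ε : ℝ} (hε : 0 < ε) (hy0 : 0 ≤ y) (hy : y ≤ m + R) :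
    ((1 + ε) * t ^ 2 - (1 + ε⁻¹) * R ^ 2 + y ^ 2) / (1 + ε) ≤ t ^ 2 + m ^ 2 := by
  rw [div_le_iff₀ (by linarith)]
  have h1 : y ^ 2 ≤ (m + R) ^ 2 := pow_le_pow_left₀ hy0 hy 2
  have h2 : (m + R) ^ 2 ≤ (1 + ε) * m ^ 2 + (1 + ε⁻¹) * R ^ 2 := by
    have h : 0 ≤ (ε * m - R) ^ 2 / ε := by positivity
    have e : (1 + ε) * m ^ 2 + (1 + ε⁻¹) * R ^ 2 - (m + R) ^ 2 = (ε * m - R) ^ 2 / ε := by field_simp; ring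
    rw [← sub_nonneg, e]; exact h
  nlinarith

/-- `(Sⁿ)⁻¹ ≤ (w⁻¹)ⁿ` for `0 < w ≤ S`. [folklore] -/
theorem inv_pow_le_of_le {S w : ℝ} (n : ℕ) (hw : 0 < w) (h : w ≤ S) : (S ^ n)⁻¹ ≤ (w⁻¹) ^ n := by
  rw [← inv_pow]; exact pow_le_pow_left₀ (inv_nonneg.2 (hw.le.trans h)) (inv_anti₀ hw h) n

/-- ★ POINTWISE SMEAR BOUND: `modulus(√(t²+m²)) ≤ 15(1+ε)⁷(T₂+y²)⁻⁷ + 9(1+ε)⁴(T₂+y²)⁻⁴` for `0 ≤ y ≤ m + R`,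
`T₂ = (1+ε)t² − (1+1/ε)R² > 0`. -/
theorem modulus_sqrt_le_smear {t m R y ε : ℝ} (hε : 0 < ε) (hy0 : 0 ≤ y) (hy : y ≤ m + R)
    (hT : 0 < (1 + ε) * t ^ 2 - (1 + ε⁻¹) * R ^ 2) :
    modulus (Real.sqrt (t ^ 2 + m ^ 2)) ≤
      15 * (1 + ε) ^ 7 * (((1 + ε) * t ^ 2 - (1 + ε⁻¹) * R ^ 2 + y ^ 2)⁻¹) ^ 7 +
        9 * (1 + ε) ^ 4 * (((1 + ε) * t ^ 2 - (1 + ε⁻¹) * R ^ 2 + y ^ 2)⁻¹) ^ 4 := by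
  have hw : 0 < (1 + ε) * t ^ 2 - (1 + ε⁻¹) * R ^ 2 + y ^ 2 := by nlinarith [sq_nonneg y]
  have hε1 : 0 < 1 + ε := by linarith
  have hS : ((1 + ε) * t ^ 2 - (1 + ε⁻¹) * R ^ 2 + y ^ 2) / (1 + ε) ≤ t ^ 2 + m ^ 2 := floor_transfer hε hy0 hy
  have hwS : 0 < ((1 + ε) * t ^ 2 - (1 + ε⁻¹) * R ^ 2 + y ^ 2) / (1 + ε) := div_pos hw hε1
  rw [modulus_sqrt_eq (by positivity : (0:ℝ) ≤ t ^ 2 + m ^ 2)]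
  have h7 := inv_pow_le_of_le 7 hwS hS
  have h4 := inv_pow_le_of_le 4 hwS hS
  have e : (((1 + ε) * t ^ 2 - (1 + ε⁻¹) * R ^ 2 + y ^ 2) / (1 + ε))⁻¹ =
      (1 + ε) * ((1 + ε) * t ^ 2 - (1 + ε⁻¹) * R ^ 2 + y ^ 2)⁻¹ := by rw [inv_div, div_eq_mul_inv]
  rw [e, mul_pow] at h7 h4
  linarith

/-! ## §2 A lattice sum is at most the integral of a cellwise majorant -/

/-- ★ `Σ_{ij} F ij ≤ ∫ g` whenever `F ij ≤ g z` for `z` in the unit cell `[i, i+1) × [j, j+1)`. [folklore] -/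
theorem tsum_le_lintegral_of_cells (F : ℤ × ℤ → ℝ≥0∞) (g : ℝ × ℝ → ℝ≥0∞)
    (h : ∀ (ij : ℤ × ℤ) (z : ℝ × ℝ), z.1 ∈ Ico (ij.1 : ℝ) (ij.1 + 1) → z.2 ∈ Ico (ij.2 : ℝ) (ij.2 + 1) → F ij ≤ g z) :
    ∑' ij, F ij ≤ ∫⁻ z, g z := by
  set cell : ℤ × ℤ → Set (ℝ × ℝ) := fun ij => Ico (ij.1 : ℝ) (ij.1 + 1) ×ˢ Ico (ij.2 : ℝ) (ij.2 + 1) with hcell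
  have hmeas : ∀ ij, MeasurableSet (cell ij) := fun ij => measurableSet_Ico.prod measurableSet_Ico
  have hdisj : Pairwise (Function.onFun Disjoint cell) := by
    intro ij kl hne
    rw [Function.onFun, Set.disjoint_left]
    rintro z ⟨hz1, hz2⟩ ⟨hz1', hz2'⟩
    apply hne
    have e1 : ij.1 = kl.1 := by
      have h1 : ⌊z.1⌋ = ij.1 := Int.floor_eq_iff.2 ⟨hz1.1, by linarith [hz1.2]⟩
      have h2 : ⌊z.1⌋ = kl.1 := Int.floor_eq_iff.2 ⟨hz1'.1, by linarith [hz1'.2]⟩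
      rw [← h1, h2]
    have e2 : ij.2 = kl.2 := by
      have h1 : ⌊z.2⌋ = ij.2 := Int.floor_eq_iff.2 ⟨hz2.1, by linarith [hz2.2]⟩
      have h2 : ⌊z.2⌋ = kl.2 := Int.floor_eq_iff.2 ⟨hz2'.1, by linarith [hz2'.2]⟩
      rw [← h1, h2]
    exact Prod.ext e1 e2
  have hcover : (⋃ ij, cell ij) = univ := by
    rw [Set.eq_univ_iff_forall]
    intro z
    rw [Set.mem_iUnion]
    exact ⟨(⌊z.1⌋, ⌊z.2⌋), ⟨Int.floor_le _, by push_cast; exact Int.lt_floor_add_one _⟩,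
      ⟨Int.floor_le _, by push_cast; exact Int.lt_floor_add_one _⟩⟩
  have hvol : ∀ ij, volume (cell ij) = 1 := fun ij => by
    rw [hcell]; dsimp only
    rw [Measure.volume_eq_prod, Measure.prod_prod, Real.volume_Ico, Real.volume_Ico]
    simp
  calc ∑' ij, F ij = ∑' ij, ∫⁻ z in cell ij, F ij := by
        congr 1; ext ij; rw [setLIntegral_const, hvol, mul_one]
    _ ≤ ∑' ij, ∫⁻ z in cell ij, g z := ENNReal.tsum_le_tsum fun ij => setLIntegral_mono' (hmeas ij) fun z hz => h ij z hz.1 hz.2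
    _ = ∫⁻ z in ⋃ ij, cell ij, g z := (lintegral_iUnion hmeas hdisj g).symm
    _ = ∫⁻ z, g z := by rw [hcover, setLIntegral_univ]

/-! ## §3 The radial integral against the exact Gram form -/

/-- the Cholesky shear `(z₁, z₂) ↦ (α z₁ + β z₂, γ z₂)`. -/
def shear (α β γ : ℝ) : (ℝ × ℝ) →ₗ[ℝ] (ℝ × ℝ) where
  toFun z := (α * z.1 + β * z.2, γ * z.2)
  map_add' z z' := by ext <;> simp <;> ring
  map_smul' c z := by ext <;> simp <;> ring

/-- Unfolding `shear`. [folklore] -/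
theorem shear_apply (α β γ : ℝ) (z : ℝ × ℝ) : shear α β γ z = (α * z.1 + β * z.2, γ * z.2) := rfl

/-- `det (shear α β γ) = α γ`. -/
theorem det_shear (α β γ : ℝ) : LinearMap.det (shear α β γ) = α * γ := by
  rw [← LinearMap.det_toMatrix (Module.Basis.finTwoProd ℝ), Matrix.det_fin_two]
  simp [LinearMap.toMatrix_apply, shear_apply]

/-- linear change of variables under the shear (Lebesgue measure on `ℝ²` is an additive Haar measure). -/
theorem lintegral_comp_shear (f : ℝ × ℝ → ℝ≥0∞) (hf : Measurable f) {α β γ : ℝ} (h : α * γ ≠ 0) :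
    ∫⁻ z, f (shear α β γ z) = ENNReal.ofReal |(α * γ)⁻¹| * ∫⁻ z, f z := by
  have hdet : LinearMap.det (shear α β γ) ≠ 0 := by rwa [det_shear]
  have hmeas : Measurable (shear α β γ) := (LinearMap.continuous_of_finiteDimensional _).measurable
  haveI : (volume : Measure (ℝ × ℝ)).IsAddHaarMeasure := by rw [Measure.volume_eq_prod]; infer_instance
  rw [← lintegral_map hf hmeas, Measure.map_linearMap_addHaar_eq_smul_addHaar _ hdet, lintegral_smul_measure, det_shear,
    smul_eq_mul]

/-- the angular integration over the polar rectangle. [folklore] -/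
theorem lintegral_polar_rect (g : ℝ → ℝ≥0∞) (hg : Measurable g) :
    ∫⁻ (p : ℝ × ℝ) in Ioi (0:ℝ) ×ˢ Ioo (-π) π, g p.1 = ENNReal.ofReal (2 * π) * ∫⁻ r in Ioi (0:ℝ), g r := by
  rw [Measure.volume_eq_prod, ← Measure.prod_restrict, lintegral_prod _ (by fun_prop)]
  simp only [lintegral_const, Measure.restrict_apply_univ, Real.volume_Ioo]
  rw [lintegral_mul_const _ hg, show π - -π = 2 * π by ring, mul_comm]

/-- ★ the radial reduction: `∫_{ℝ²} (T₂ + |p|²)⁻ⁿ = 2π ∫₀^∞ (T₂ + r²)⁻ⁿ r dr`. [folklore] -/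
theorem lintegral_radial (n : ℕ) {T2 : ℝ} (hT2 : 0 ≤ T2) :
    ∫⁻ p : ℝ × ℝ, ENNReal.ofReal (((T2 + (p.1 ^ 2 + p.2 ^ 2))⁻¹) ^ n) =
      ENNReal.ofReal (2 * π) * ∫⁻ r in Ioi (0:ℝ), ENNReal.ofReal (((T2 + r ^ 2)⁻¹) ^ n * r) := by
  have hp := lintegral_comp_polarCoord_symm (fun q : ℝ × ℝ => ENNReal.ofReal (((T2 + (q.1 ^ 2 + q.2 ^ 2))⁻¹) ^ n))
  simp only [polarCoord_symm_apply, polarCoord_target, smul_eq_mul] at hp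
  have e3 : ∀ p : ℝ × ℝ, (p.1 * cos p.2) ^ 2 + (p.1 * sin p.2) ^ 2 = p.1 ^ 2 := fun p => by
    have h := cos_sq_add_sin_sq p.2
    calc (p.1 * cos p.2) ^ 2 + (p.1 * sin p.2) ^ 2 = p.1 ^ 2 * (cos p.2 ^ 2 + sin p.2 ^ 2) := by ring
      _ = p.1 ^ 2 := by rw [h, mul_one]
  simp_rw [e3] at hp
  rw [← hp, lintegral_polar_rect (fun r => ENNReal.ofReal r * ENNReal.ofReal (((T2 + r ^ 2)⁻¹) ^ n)) (by fun_prop)]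
  have e4 : ∀ r : ℝ, ENNReal.ofReal r * ENNReal.ofReal (((T2 + r ^ 2)⁻¹) ^ n) = ENNReal.ofReal (((T2 + r ^ 2)⁻¹) ^ n * r) :=
    fun r => by rw [mul_comm, ENNReal.ofReal_mul (by positivity)]
  simp_rw [e4]

/-- `∫₀^∞ (T₂ + r²)⁻⁴ r dr = T₂⁻³/6`. [folklore] -/
theorem integral_Ioi_four {T2 : ℝ} (hT2 : 0 < T2) : ∫ r in Ioi (0:ℝ), ((T2 + r ^ 2)⁻¹) ^ 4 * r = (T2⁻¹) ^ 3 / 6 := by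
  have hpos : ∀ r : ℝ, 0 < T2 + r ^ 2 := fun r => by positivity
  have hderiv : ∀ r ∈ Ici (0:ℝ), HasDerivAt (fun r : ℝ => -((T2 + r ^ 2)⁻¹) ^ 3 / 6) (((T2 + r ^ 2)⁻¹) ^ 4 * r) r := by
    intro r _
    have h1 : HasDerivAt (fun r : ℝ => T2 + r ^ 2) (2 * r) r := by
      simpa using ((hasDerivAt_pow 2 r).const_add T2)
    have h2 : HasDerivAt (fun x : ℝ => (T2 + x ^ 2)⁻¹) (-(2 * r) / (T2 + r ^ 2) ^ 2) r := h1.inv (hpos r).ne'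
    have h3 : HasDerivAt (fun x : ℝ => -((T2 + x ^ 2)⁻¹) ^ 3 / 6)
        (-(((3 : ℕ) : ℝ) * ((T2 + r ^ 2)⁻¹) ^ (3 - 1) * (-(2 * r) / (T2 + r ^ 2) ^ 2)) / 6) r := ((h2.pow 3).neg).div_const 6
    have e : -(((3 : ℕ) : ℝ) * ((T2 + r ^ 2)⁻¹) ^ (3 - 1) * (-(2 * r) / (T2 + r ^ 2) ^ 2)) / 6 = ((T2 + r ^ 2)⁻¹) ^ 4 * r := by
      rw [div_eq_mul_inv (-(2 * r)), ← inv_pow]; push_cast; ring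
    rw [e] at h3
    exact h3
  have hlim : Filter.Tendsto (fun r : ℝ => -((T2 + r ^ 2)⁻¹) ^ 3 / 6) Filter.atTop (nhds (-(0:ℝ) ^ 3 / 6)) := by
    have h0 : Filter.Tendsto (fun r : ℝ => T2 + r ^ 2) Filter.atTop Filter.atTop :=
      Filter.tendsto_atTop_add_const_left _ _ (Filter.tendsto_pow_atTop two_ne_zero)
    exact ((h0.inv_tendsto_atTop).pow 3).neg.div_const 6
  rw [integral_Ioi_of_hasDerivAt_of_nonneg' hderiv (fun r hr => mul_nonneg (by positivity) (le_of_lt hr)) hlim]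
  simp only [ne_eq, OfNat.ofNat_ne_zero, not_false_eq_true, zero_pow, neg_zero, zero_div, zero_sub, inv_pow]
  ring

/-- the `ℝ≥0∞` form of `integral_Ioi_four`. -/
theorem lintegral_Ioi_four {T2 : ℝ} (hT2 : 0 < T2) :
    ∫⁻ r in Ioi (0:ℝ), ENNReal.ofReal (((T2 + r ^ 2)⁻¹) ^ 4 * r) = ENNReal.ofReal ((T2⁻¹) ^ 3 / 6) := by
  have hpos : ∀ r : ℝ, 0 < T2 + r ^ 2 := fun r => by positivity
  have hderiv : ∀ r ∈ Ici (0:ℝ), HasDerivAt (fun r : ℝ => -((T2 + r ^ 2)⁻¹) ^ 3 / 6) (((T2 + r ^ 2)⁻¹) ^ 4 * r) r := by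
    intro r _
    have h1 : HasDerivAt (fun r : ℝ => T2 + r ^ 2) (2 * r) r := by
      simpa using ((hasDerivAt_pow 2 r).const_add T2)
    have h2 : HasDerivAt (fun x : ℝ => (T2 + x ^ 2)⁻¹) (-(2 * r) / (T2 + r ^ 2) ^ 2) r := h1.inv (hpos r).ne'
    have h3 : HasDerivAt (fun x : ℝ => -((T2 + x ^ 2)⁻¹) ^ 3 / 6)
        (-(((3 : ℕ) : ℝ) * ((T2 + r ^ 2)⁻¹) ^ (3 - 1) * (-(2 * r) / (T2 + r ^ 2) ^ 2)) / 6) r := ((h2.pow 3).neg).div_const 6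
    have e : -(((3 : ℕ) : ℝ) * ((T2 + r ^ 2)⁻¹) ^ (3 - 1) * (-(2 * r) / (T2 + r ^ 2) ^ 2)) / 6 = ((T2 + r ^ 2)⁻¹) ^ 4 * r := by
      rw [div_eq_mul_inv (-(2 * r)), ← inv_pow]; push_cast; ring
    rw [e] at h3
    exact h3
  have hlim : Filter.Tendsto (fun r : ℝ => -((T2 + r ^ 2)⁻¹) ^ 3 / 6) Filter.atTop (nhds (-(0:ℝ) ^ 3 / 6)) := by
    have h0 : Filter.Tendsto (fun r : ℝ => T2 + r ^ 2) Filter.atTop Filter.atTop :=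
      Filter.tendsto_atTop_add_const_left _ _ (Filter.tendsto_pow_atTop two_ne_zero)
    exact ((h0.inv_tendsto_atTop).pow 3).neg.div_const 6
  have hint := integrableOn_Ioi_deriv_of_nonneg' hderiv (fun r hr => mul_nonneg (by positivity) (le_of_lt hr)) hlim
  have hnn : 0 ≤ᵐ[volume.restrict (Ioi (0:ℝ))] fun r : ℝ => ((T2 + r ^ 2)⁻¹) ^ 4 * r :=
    (ae_restrict_iff' measurableSet_Ioi).2 (Filter.Eventually.of_forall fun r hr => mul_nonneg (by positivity) (le_of_lt hr))
  rw [← ofReal_integral_eq_lintegral_ofReal hint hnn, integral_Ioi_four hT2]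

/-- `∫₀^∞ (T₂ + r²)⁻⁷ r dr = T₂⁻⁶/12`. [folklore] -/
theorem integral_Ioi_seven {T2 : ℝ} (hT2 : 0 < T2) : ∫ r in Ioi (0:ℝ), ((T2 + r ^ 2)⁻¹) ^ 7 * r = (T2⁻¹) ^ 6 / 12 := by
  have hpos : ∀ r : ℝ, 0 < T2 + r ^ 2 := fun r => by positivity
  have hderiv : ∀ r ∈ Ici (0:ℝ), HasDerivAt (fun r : ℝ => -((T2 + r ^ 2)⁻¹) ^ 6 / 12) (((T2 + r ^ 2)⁻¹) ^ 7 * r) r := by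
    intro r _
    have h1 : HasDerivAt (fun r : ℝ => T2 + r ^ 2) (2 * r) r := by
      simpa using ((hasDerivAt_pow 2 r).const_add T2)
    have h2 : HasDerivAt (fun x : ℝ => (T2 + x ^ 2)⁻¹) (-(2 * r) / (T2 + r ^ 2) ^ 2) r := h1.inv (hpos r).ne'
    have h3 : HasDerivAt (fun x : ℝ => -((T2 + x ^ 2)⁻¹) ^ 6 / 12)
        (-(((6 : ℕ) : ℝ) * ((T2 + r ^ 2)⁻¹) ^ (6 - 1) * (-(2 * r) / (T2 + r ^ 2) ^ 2)) / 12) r := ((h2.pow 6).neg).div_const 12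
    have e : -(((6 : ℕ) : ℝ) * ((T2 + r ^ 2)⁻¹) ^ (6 - 1) * (-(2 * r) / (T2 + r ^ 2) ^ 2)) / 12 = ((T2 + r ^ 2)⁻¹) ^ 7 * r := by
      rw [div_eq_mul_inv (-(2 * r)), ← inv_pow]; push_cast; ring
    rw [e] at h3
    exact h3
  have hlim : Filter.Tendsto (fun r : ℝ => -((T2 + r ^ 2)⁻¹) ^ 6 / 12) Filter.atTop (nhds (-(0:ℝ) ^ 6 / 12)) := by
    have h0 : Filter.Tendsto (fun r : ℝ => T2 + r ^ 2) Filter.atTop Filter.atTop :=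
      Filter.tendsto_atTop_add_const_left _ _ (Filter.tendsto_pow_atTop two_ne_zero)
    exact ((h0.inv_tendsto_atTop).pow 6).neg.div_const 12
  rw [integral_Ioi_of_hasDerivAt_of_nonneg' hderiv (fun r hr => mul_nonneg (by positivity) (le_of_lt hr)) hlim]
  simp only [ne_eq, OfNat.ofNat_ne_zero, not_false_eq_true, zero_pow, neg_zero, zero_div, zero_sub, inv_pow]
  ring

/-- the `ℝ≥0∞` form of `integral_Ioi_seven`. -/
theorem lintegral_Ioi_seven {T2 : ℝ} (hT2 : 0 < T2) :
    ∫⁻ r in Ioi (0:ℝ), ENNReal.ofReal (((T2 + r ^ 2)⁻¹) ^ 7 * r) = ENNReal.ofReal ((T2⁻¹) ^ 6 / 12) := by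
  have hpos : ∀ r : ℝ, 0 < T2 + r ^ 2 := fun r => by positivity
  have hderiv : ∀ r ∈ Ici (0:ℝ), HasDerivAt (fun r : ℝ => -((T2 + r ^ 2)⁻¹) ^ 6 / 12) (((T2 + r ^ 2)⁻¹) ^ 7 * r) r := by
    intro r _
    have h1 : HasDerivAt (fun r : ℝ => T2 + r ^ 2) (2 * r) r := by
      simpa using ((hasDerivAt_pow 2 r).const_add T2)
    have h2 : HasDerivAt (fun x : ℝ => (T2 + x ^ 2)⁻¹) (-(2 * r) / (T2 + r ^ 2) ^ 2) r := h1.inv (hpos r).ne'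
    have h3 : HasDerivAt (fun x : ℝ => -((T2 + x ^ 2)⁻¹) ^ 6 / 12)
        (-(((6 : ℕ) : ℝ) * ((T2 + r ^ 2)⁻¹) ^ (6 - 1) * (-(2 * r) / (T2 + r ^ 2) ^ 2)) / 12) r := ((h2.pow 6).neg).div_const 12
    have e : -(((6 : ℕ) : ℝ) * ((T2 + r ^ 2)⁻¹) ^ (6 - 1) * (-(2 * r) / (T2 + r ^ 2) ^ 2)) / 12 = ((T2 + r ^ 2)⁻¹) ^ 7 * r := by
      rw [div_eq_mul_inv (-(2 * r)), ← inv_pow]; push_cast; ring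
    rw [e] at h3
    exact h3
  have hlim : Filter.Tendsto (fun r : ℝ => -((T2 + r ^ 2)⁻¹) ^ 6 / 12) Filter.atTop (nhds (-(0:ℝ) ^ 6 / 12)) := by
    have h0 : Filter.Tendsto (fun r : ℝ => T2 + r ^ 2) Filter.atTop Filter.atTop :=
      Filter.tendsto_atTop_add_const_left _ _ (Filter.tendsto_pow_atTop two_ne_zero)
    exact ((h0.inv_tendsto_atTop).pow 6).neg.div_const 12
  have hint := integrableOn_Ioi_deriv_of_nonneg' hderiv (fun r hr => mul_nonneg (by positivity) (le_of_lt hr)) hlim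
  have hnn : 0 ≤ᵐ[volume.restrict (Ioi (0:ℝ))] fun r : ℝ => ((T2 + r ^ 2)⁻¹) ^ 7 * r :=
    (ae_restrict_iff' measurableSet_Ioi).2 (Filter.Eventually.of_forall fun r hr => mul_nonneg (by positivity) (le_of_lt hr))
  rw [← ofReal_integral_eq_lintegral_ofReal hint hnn, integral_Ioi_seven hT2]

/-- `‖s a + t b‖² = ‖a‖² s² + ‖b‖² t² + 2⟪a,b⟫ s t`. [folklore] -/
theorem norm_sq_lin (a b : E3) (s t : ℝ) :
    ‖s • a + t • b‖ ^ 2 = ‖a‖ ^ 2 * s ^ 2 + ‖b‖ ^ 2 * t ^ 2 + 2 * ⟪a, b⟫ * (s * t) := by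
  rw [norm_add_sq_real, norm_smul, norm_smul, real_inner_smul_left, real_inner_smul_right, Real.norm_eq_abs, Real.norm_eq_abs,
    mul_pow, mul_pow, sq_abs, sq_abs]
  ring

/-- the Cholesky identity: `‖u₁ a + u₂ b‖² = (‖a‖u₁ + (p/‖a‖)u₂)² + ((√G/‖a‖) u₂)²`. [folklore] -/
theorem norm_sq_eq_shear {a b : E3} (ha : a ≠ 0) (u : ℝ × ℝ) :
    ‖u.1 • a + u.2 • b‖ ^ 2 =
      (shear ‖a‖ (⟪a, b⟫ / ‖a‖) (Real.sqrt (‖a‖ ^ 2 * ‖b‖ ^ 2 - ⟪a, b⟫ ^ 2) / ‖a‖) u).1 ^ 2 +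
        (shear ‖a‖ (⟪a, b⟫ / ‖a‖) (Real.sqrt (‖a‖ ^ 2 * ‖b‖ ^ 2 - ⟪a, b⟫ ^ 2) / ‖a‖) u).2 ^ 2 := by
  have hx : ‖a‖ ≠ 0 := norm_ne_zero_iff.2 ha
  have hG : 0 ≤ ‖a‖ ^ 2 * ‖b‖ ^ 2 - ⟪a, b⟫ ^ 2 := by
    have hcs : ⟪a, b⟫ ^ 2 ≤ (‖a‖ * ‖b‖) ^ 2 := by
      rw [← sq_abs]; exact pow_le_pow_left₀ (abs_nonneg _) (abs_real_inner_le_norm a b) 2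
    rw [mul_pow] at hcs; linarith
  have hs : Real.sqrt (‖a‖ ^ 2 * ‖b‖ ^ 2 - ⟪a, b⟫ ^ 2) ^ 2 = ‖a‖ ^ 2 * ‖b‖ ^ 2 - ⟪a, b⟫ ^ 2 := Real.sq_sqrt hG
  rw [shear_apply, norm_sq_lin]
  dsimp only
  field_simp
  linear_combination (-(u.2 ^ 2)) * hs

/-- ★★ THE RADIAL INTEGRAL AGAINST THE GRAM FORM:
`∫_{ℝ²} (T₂ + ‖(c₁+z₁) a + (c₂+z₂) b‖²)⁻ⁿ dz = (√G)⁻¹ · 2π ∫₀^∞ (T₂+r²)⁻ⁿ r dr` for independent `a, b`. -/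
theorem lintegral_quadForm {a b : E3} (hab : LinearIndependent ℝ ![a, b]) {T2 : ℝ} (hT2 : 0 ≤ T2) (c₁ c₂ : ℝ) (n : ℕ) :
    ∫⁻ z : ℝ × ℝ, ENNReal.ofReal (((T2 + ‖(c₁ + z.1) • a + (c₂ + z.2) • b‖ ^ 2)⁻¹) ^ n) =
      ENNReal.ofReal (Real.sqrt (‖a‖ ^ 2 * ‖b‖ ^ 2 - ⟪a, b⟫ ^ 2))⁻¹ *
        (ENNReal.ofReal (2 * π) * ∫⁻ r in Ioi (0:ℝ), ENNReal.ofReal (((T2 + r ^ 2)⁻¹) ^ n * r)) := by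
  have ha0 : a ≠ 0 := by simpa using hab.ne_zero 0
  have hx : ‖a‖ ≠ 0 := norm_ne_zero_iff.2 ha0
  have hG := gram_pos hab
  have hsG : 0 < Real.sqrt (‖a‖ ^ 2 * ‖b‖ ^ 2 - ⟪a, b⟫ ^ 2) := Real.sqrt_pos.2 hG
  haveI : (volume : Measure (ℝ × ℝ)).IsAddHaarMeasure := by rw [Measure.volume_eq_prod]; infer_instance
  -- translation
  have htr := lintegral_add_left_eq_self (μ := (volume : Measure (ℝ × ℝ)))
    (fun u : ℝ × ℝ => ENNReal.ofReal (((T2 + ‖u.1 • a + u.2 • b‖ ^ 2)⁻¹) ^ n)) (c₁, c₂)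
  simp only [Prod.fst_add, Prod.snd_add] at htr
  rw [htr]
  -- Cholesky shear
  simp_rw [norm_sq_eq_shear ha0]
  have hαγ : ‖a‖ * (Real.sqrt (‖a‖ ^ 2 * ‖b‖ ^ 2 - ⟪a, b⟫ ^ 2) / ‖a‖) = Real.sqrt (‖a‖ ^ 2 * ‖b‖ ^ 2 - ⟪a, b⟫ ^ 2) := by
    field_simp
  have hne : ‖a‖ * (Real.sqrt (‖a‖ ^ 2 * ‖b‖ ^ 2 - ⟪a, b⟫ ^ 2) / ‖a‖) ≠ 0 := by rw [hαγ]; exact hsG.ne'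
  have hsh := lintegral_comp_shear (fun v : ℝ × ℝ => ENNReal.ofReal (((T2 + (v.1 ^ 2 + v.2 ^ 2))⁻¹) ^ n)) (by fun_prop)
    (β := ⟪a, b⟫ / ‖a‖) hne
  rw [hsh, hαγ, abs_of_pos (inv_pos.2 hsG), lintegral_radial n hT2]

/-- ★ `n = 4`: `∫_{ℝ²} (T₂ + ‖(c₁+z₁) a + (c₂+z₂) b‖²)⁻⁴ dz = π/(3 √G T₂³)`. -/
theorem lintegral_quadForm_four {a b : E3} (hab : LinearIndependent ℝ ![a, b]) {T2 : ℝ} (hT2 : 0 < T2) (c₁ c₂ : ℝ) :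
    ∫⁻ z : ℝ × ℝ, ENNReal.ofReal (((T2 + ‖(c₁ + z.1) • a + (c₂ + z.2) • b‖ ^ 2)⁻¹) ^ 4) =
      ENNReal.ofReal (π / (3 * Real.sqrt (‖a‖ ^ 2 * ‖b‖ ^ 2 - ⟪a, b⟫ ^ 2) * T2 ^ 3)) := by
  have hsG : 0 < Real.sqrt (‖a‖ ^ 2 * ‖b‖ ^ 2 - ⟪a, b⟫ ^ 2) := Real.sqrt_pos.2 (gram_pos hab)
  rw [lintegral_quadForm hab hT2.le c₁ c₂ 4, lintegral_Ioi_four hT2, ← ENNReal.ofReal_mul (by positivity),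
    ← ENNReal.ofReal_mul (by positivity)]
  congr 1
  field_simp
  ring

/-- ★ `n = 7`: `∫_{ℝ²} (T₂ + ‖(c₁+z₁) a + (c₂+z₂) b‖²)⁻⁷ dz = π/(6 √G T₂⁶)`. -/
theorem lintegral_quadForm_seven {a b : E3} (hab : LinearIndependent ℝ ![a, b]) {T2 : ℝ} (hT2 : 0 < T2) (c₁ c₂ : ℝ) :
    ∫⁻ z : ℝ × ℝ, ENNReal.ofReal (((T2 + ‖(c₁ + z.1) • a + (c₂ + z.2) • b‖ ^ 2)⁻¹) ^ 7) =
      ENNReal.ofReal (π / (6 * Real.sqrt (‖a‖ ^ 2 * ‖b‖ ^ 2 - ⟪a, b⟫ ^ 2) * T2 ^ 6)) := by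
  have hsG : 0 < Real.sqrt (‖a‖ ^ 2 * ‖b‖ ^ 2 - ⟪a, b⟫ ^ 2) := Real.sqrt_pos.2 (gram_pos hab)
  rw [lintegral_quadForm hab hT2.le c₁ c₂ 7, lintegral_Ioi_seven hT2, ← ENNReal.ofReal_mul (by positivity),
    ← ENNReal.ofReal_mul (by positivity)]
  congr 1
  field_simp
  ring

/-! ## §4 The smeared lattice-sum bound -/

/-- ★★★ THE SMEARED LATTICE SUM.  For independent planar periods `a, b` (Gram determinant `G`), a height floor `t > 0`, a planar
discrepancy `d ≥ 0`, a cell radius `R_c ≥ ‖ζ₁ a + ζ₂ b‖` (`|ζ₁|, |ζ₂| ≤ ½`), `ε > 0` with `T₂ = (1+ε)t² − (1+1/ε)(d+R_c)² > 0`, and planar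
floors `m_ij ≥ 0` with `‖(i+c₁) a + (j+c₂) b‖ ≤ m_ij + d`: the family `modulus(√(t² + m_ij²))` is summable with sum
`≤ (π/√G)·[15(1+ε)⁷/(6T₂⁶) + 9(1+ε)⁴/(3T₂³)]`. -/
theorem tsum_modulus_le_smear {a b : E3} (hab : LinearIndependent ℝ ![a, b]) {t d Rc ε : ℝ} (hε : 0 < ε)
    (hRc : ∀ ζ₁ ζ₂ : ℝ, |ζ₁| ≤ 1 / 2 → |ζ₂| ≤ 1 / 2 → ‖ζ₁ • a + ζ₂ • b‖ ≤ Rc)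
    (hT : 0 < (1 + ε) * t ^ 2 - (1 + ε⁻¹) * (d + Rc) ^ 2) (c₁ c₂ : ℝ) {m : ℤ × ℤ → ℝ}
    (hm : ∀ ij : ℤ × ℤ, ‖((ij.1 : ℝ) + c₁) • a + ((ij.2 : ℝ) + c₂) • b‖ ≤ m ij + d) :
    Summable (fun ij : ℤ × ℤ => modulus (Real.sqrt (t ^ 2 + m ij ^ 2))) ∧
      ∑' ij : ℤ × ℤ, modulus (Real.sqrt (t ^ 2 + m ij ^ 2)) ≤
        π / Real.sqrt (‖a‖ ^ 2 * ‖b‖ ^ 2 - ⟪a, b⟫ ^ 2) *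
          (15 * (1 + ε) ^ 7 / (6 * ((1 + ε) * t ^ 2 - (1 + ε⁻¹) * (d + Rc) ^ 2) ^ 6) +
            9 * (1 + ε) ^ 4 / (3 * ((1 + ε) * t ^ 2 - (1 + ε⁻¹) * (d + Rc) ^ 2) ^ 3)) := by
  set T2 := (1 + ε) * t ^ 2 - (1 + ε⁻¹) * (d + Rc) ^ 2 with hT2
  have hsG : 0 < Real.sqrt (‖a‖ ^ 2 * ‖b‖ ^ 2 - ⟪a, b⟫ ^ 2) := Real.sqrt_pos.2 (gram_pos hab)
  have hε1 : 0 ≤ 1 + ε := by linarith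
  -- the cellwise majorant
  set g : ℝ × ℝ → ℝ≥0∞ := fun z => ENNReal.ofReal
    (15 * (1 + ε) ^ 7 * ((T2 + ‖((c₁ - 1 / 2) + z.1) • a + ((c₂ - 1 / 2) + z.2) • b‖ ^ 2)⁻¹) ^ 7 +
      9 * (1 + ε) ^ 4 * ((T2 + ‖((c₁ - 1 / 2) + z.1) • a + ((c₂ - 1 / 2) + z.2) • b‖ ^ 2)⁻¹) ^ 4) with hg
  have hF : ∀ (ij : ℤ × ℤ) (z : ℝ × ℝ), z.1 ∈ Ico (ij.1 : ℝ) (ij.1 + 1) → z.2 ∈ Ico (ij.2 : ℝ) (ij.2 + 1) →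
      ENNReal.ofReal (modulus (Real.sqrt (t ^ 2 + m ij ^ 2))) ≤ g z := by
    intro ij z hz1 hz2
    have hdec : ((c₁ - 1 / 2) + z.1) • a + ((c₂ - 1 / 2) + z.2) • b =
        (((ij.1 : ℝ) + c₁) • a + ((ij.2 : ℝ) + c₂) • b) + ((z.1 - ij.1 - 1 / 2) • a + (z.2 - ij.2 - 1 / 2) • b) := by
      module
    have hζ := hRc (z.1 - ij.1 - 1 / 2) (z.2 - ij.2 - 1 / 2) (abs_le.2 ⟨by linarith [hz1.1], by linarith [hz1.2]⟩)
      (abs_le.2 ⟨by linarith [hz2.1], by linarith [hz2.2]⟩)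
    have hy : ‖((c₁ - 1 / 2) + z.1) • a + ((c₂ - 1 / 2) + z.2) • b‖ ≤ m ij + (d + Rc) := by
      rw [hdec]; refine (norm_add_le _ _).trans ?_; linarith [hm ij]
    exact ENNReal.ofReal_le_ofReal (modulus_sqrt_le_smear hε (norm_nonneg _) hy hT)
  -- the integral of the majorant
  have hI : ∫⁻ z, g z = ENNReal.ofReal (15 * (1 + ε) ^ 7 * (π / (6 * Real.sqrt (‖a‖ ^ 2 * ‖b‖ ^ 2 - ⟪a, b⟫ ^ 2) * T2 ^ 6)) +
      9 * (1 + ε) ^ 4 * (π / (3 * Real.sqrt (‖a‖ ^ 2 * ‖b‖ ^ 2 - ⟪a, b⟫ ^ 2) * T2 ^ 3))) := by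
    have hm7 : Measurable fun z : ℝ × ℝ =>
        ENNReal.ofReal (((T2 + ‖((c₁ - 1 / 2) + z.1) • a + ((c₂ - 1 / 2) + z.2) • b‖ ^ 2)⁻¹) ^ 7) := by fun_prop
    have hm4 : Measurable fun z : ℝ × ℝ =>
        ENNReal.ofReal (((T2 + ‖((c₁ - 1 / 2) + z.1) • a + ((c₂ - 1 / 2) + z.2) • b‖ ^ 2)⁻¹) ^ 4) := by fun_prop
    have e1 : ∀ z : ℝ × ℝ, g z = ENNReal.ofReal (15 * (1 + ε) ^ 7) *
        ENNReal.ofReal (((T2 + ‖((c₁ - 1 / 2) + z.1) • a + ((c₂ - 1 / 2) + z.2) • b‖ ^ 2)⁻¹) ^ 7) +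
        ENNReal.ofReal (9 * (1 + ε) ^ 4) *
        ENNReal.ofReal (((T2 + ‖((c₁ - 1 / 2) + z.1) • a + ((c₂ - 1 / 2) + z.2) • b‖ ^ 2)⁻¹) ^ 4) := by
      intro z
      rw [hg, ← ENNReal.ofReal_mul (by positivity), ← ENNReal.ofReal_mul (by positivity), ← ENNReal.ofReal_add (by positivity)
        (by positivity)]
    simp_rw [e1]
    rw [lintegral_add_left (hm7.const_mul _), lintegral_const_mul _ hm7, lintegral_const_mul _ hm4,
      lintegral_quadForm_seven hab hT (c₁ - 1 / 2) (c₂ - 1 / 2), lintegral_quadForm_four hab hT (c₁ - 1 / 2) (c₂ - 1 / 2),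
      ← ENNReal.ofReal_mul (by positivity), ← ENNReal.ofReal_mul (by positivity), ← ENNReal.ofReal_add (by positivity) (by positivity)]
  -- conclusion
  have hle : ∑' ij : ℤ × ℤ, ENNReal.ofReal (modulus (Real.sqrt (t ^ 2 + m ij ^ 2))) ≤ _ :=
    (tsum_le_lintegral_of_cells _ g hF).trans_eq hI
  have hne : ∑' ij : ℤ × ℤ, ENNReal.ofReal (modulus (Real.sqrt (t ^ 2 + m ij ^ 2))) ≠ ⊤ :=
    ne_top_of_le_ne_top ENNReal.ofReal_ne_top hle
  have hsum : Summable fun ij : ℤ × ℤ => modulus (Real.sqrt (t ^ 2 + m ij ^ 2)) := by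
    refine (ENNReal.summable_toReal hne).congr fun ij => ?_
    exact ENNReal.toReal_ofReal (modulus_nonneg _)
  refine ⟨hsum, ?_⟩
  have e2 : ∑' ij : ℤ × ℤ, modulus (Real.sqrt (t ^ 2 + m ij ^ 2)) =
      (∑' ij : ℤ × ℤ, ENNReal.ofReal (modulus (Real.sqrt (t ^ 2 + m ij ^ 2)))).toReal := by
    rw [ENNReal.tsum_toReal_eq (fun _ => ENNReal.ofReal_ne_top)]
    exact tsum_congr fun ij => (ENNReal.toReal_ofReal (modulus_nonneg _)).symm
  rw [e2]
  refine (ENNReal.toReal_mono ENNReal.ofReal_ne_top hle).trans ?_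
  rw [ENNReal.toReal_ofReal (by positivity)]
  apply le_of_eq
  field_simp

end Summit.AtomisticToContinuum.Crystallization.Theorems.ChartedPlanarOrderLatticeSmear
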